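import Literature.Analysis.FluidPDE.FracNSApriori
import Literature.Analysis.FluidPDE.FracNSContinuation
import Literature.Analysis.FluidPDE.DeRosaGluingPotential
import Literature.Analysis.FluidPDE.OnsagerBDSVCommutatorHolds
import Literature.Analysis.FunctionSpaces.ContDiffHolderAlgebra
import HarnessLib

/-!
# Local existence for the fractional Navier–Stokes equations on the life span `c/‖u₀‖_{1+α}`
# from short-time existence: the continuation argument (De Rosa 2019, Thm. 3.4 / Prop. 3.5)

L. De Rosa, *Infinitely many Leray–Hopf solutions for the fractional Navier–Stokes equations*,
Comm. PDE 44 (2019) 335–365 = arXiv:1801.10235, §3.2, Thm. 3.4 with Prop. 3.5: "for any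
`0 < α < 1` there exists a constant `c = c(α) > 0` with the following property. Given any initial
data `u₀ ∈ C^∞`, and `T ≤ c‖u₀‖_{1+α}⁻¹`, there exists a unique solution
`v : 𝕋³ × [0,T] → ℝ³` of (3.8)". The printed proof of Thm. 3.4 is the energy method (short-time
existence in `H^m`, life span controlled by a high norm of the datum), and Prop. 3.5 supplies the
a priori bounds (3.9) `‖v(t)‖_{N+α} ≲ ‖u₀‖_{N+α}`, `N ≥ 1`, on `[0, c‖u₀‖_{1+α}⁻¹]`, whence the
life span by the classical continuation argument (Majda–Bertozzi 2002, §3.2.3, proof of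
Thm. 3.5 / Cor. 3.2: restart, identify on the overlap by uniqueness, glue).

This file (theorems only; no definitions, no named facts) proves that continuation step in the
tree's vocabulary, the forward-in-time twin of `BDSV.localEulerHolder_of_shortTime_of_propagation`
(`OnsagerBDSVLocalEulerProofs.lean`), with every ingredient but the short-time existence proved:

* `DeRosa.localExistence₀_of_shortTime` — from a **short-time existence statement** for smooth
  divergence-free data with `‖u₀‖_{4+α} ≤ M` (a smooth solution of
  `∂ₜv + (v·∇)v + ∇p + ν(-Δ)^γ v = 0`, `div v = 0` on `[0, h(M)] × 𝕋³` with `v(0) = u₀` and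
  zero-mean pressure — the output of the Fourier–Galerkin energy method,
  `GalerkinSmoothSolution.lean`), the existence clause of Thm. 3.4 / Prop. 3.5 in the exact shape
  consumed by `DeRosa.gluingStage_of_localExistence₀_of_commutatorCZBound`: for `0 < α < 1`,
  `0 < γ < 1` there is `c > 0` such that for `ν > 0`, smooth divergence-free `u₀` with
  `‖u₀‖_{1+α} ≤ K` and `T'K ≤ c` there is a smooth solution on `[0, T'] × 𝕋³` with `v(0) = u₀`.
  Proof: `c` and `C` are the constants of the a priori estimate `DeRosa.fracNSApriori` (levels
  `1 ≤ N ≤ 4`); with `U = max K (c/T')`, `Λ = max 1 (X/U)` (`X` the sum of the `C^{N,α}` norms of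
  `u₀`, `N ≤ 4`) and `B = C U Λ³`, every smooth solution through `u₀` on `[0, b] ⊆ [0, T']` obeys
  `‖v(t)‖_{4+α} ≤ B`, so the short-time theorem restarted from `v(t)` always lives on a window of
  the fixed length `h(B)`, and `Torus.IsFracNSReynoldsOn.extend_forward` (`FracNSContinuation.lean`:
  restart, forward uniqueness, gluing) reaches `T'` in `⌈2T'/h⌉` steps.
* `DeRosa.gluingStage_of_shortTime` — hence De Rosa's gluing stage `DeRosa.gluingStage` from the
  short-time existence statement alone (`DeRosa.gluingStage_of_localExistence₀_of_commutatorCZBound`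
  with the commutator estimate `BDSV.commutatorCZBound_holds`, proved in the tree).

## References

* L. De Rosa, Comm. PDE 44 (2019) 335–365 = arXiv:1801.10235, §3.2, Thm. 3.4, Prop. 3.5 and its
  proof; §5.2. [`Derosa2018`]
* A. J. Majda, A. L. Bertozzi, *Vorticity and Incompressible Flow*, CUP 2002, §3.2.2 Thm. 3.4,
  §3.2.3 proof of Thm. 3.5 / Cor. 3.2 (continuation). [`MajdaBertozziCUP2002`]
-/

open MeasureTheory Set Filter
open scoped NNReal ENNReal ContDiff Topology

noncomputable section

namespace Literature.Analysis.FluidPDE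

namespace DeRosa

open FunctionSpaces FunctionSpaces.Torus

/-- **De Rosa 2019, Thm. 3.4 / Prop. 3.5 (existence clause) from short-time existence, by
continuation.** Suppose that for all `0 < α < 1`, `0 < γ < 1`, `ν > 0` and `M > 0` there is
`h > 0` such that every smooth divergence-free `u₀ : 𝕋³ → ℝ³` with `‖u₀‖_{4+α} ≤ M` launches a
smooth solution `(v, p)` of the fractional Navier–Stokes equations on `[0, h] × 𝕋³` with
`v(0) = u₀` and `∫ p(t) = 0` (short-time existence by the energy method). Then for `0 < α < 1`,
`0 < γ < 1` there is `c > 0` such that for every `ν > 0`, every smooth divergence-free `u₀`, every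
`K ≥ 0` with `‖u₀‖_{1+α} ≤ K` and every `T' > 0` with `T'K ≤ c` there is a smooth solution on
`[0, T'] × 𝕋³` with `v(0) = u₀` ("Given any initial data `u₀ ∈ C^∞`, and `T ≤ c‖u₀‖_{1+α}⁻¹`,
there exists a unique solution `v` of (3.8) on `[0,T]`"; the a priori bounds (3.9) are
`DeRosa.fracNSApriori`, the restart/uniqueness/gluing induction is
`Torus.IsFracNSReynoldsOn.extend_forward`). [cite: Derosa2018, §3.2 Thm. 3.4, Prop. 3.5] -/
theorem localExistence₀_of_shortTime
    (hshort : ∀ α : ℝ, 0 < α → α < 1 → ∀ γ : ℝ, 0 < γ → γ < 1 → ∀ ν : ℝ, 0 < ν → ∀ M : ℝ, 0 < M →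
      ∃ h : ℝ, 0 < h ∧ ∀ u₀ : UnitAddTorus (Fin 3) → EuclideanSpace ℝ (Fin 3),
        IsSmooth u₀ → IsDivFree u₀ →
          Torus.eContDiffHolderNorm 4 (Real.toNNReal α) u₀ ≤ ENNReal.ofReal M →
            ∃ (v : ℝ → UnitAddTorus (Fin 3) → EuclideanSpace ℝ (Fin 3)) (p : ℝ → UnitAddTorus (Fin 3) → ℝ),
              Torus.IsFracNSReynoldsOn (Icc 0 h) γ ν v p (fun _ _ _ => 0) ∧ v 0 = u₀ ∧
                ∀ t ∈ Icc 0 h, HasZeroMean (p t)) :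
    ∀ α : ℝ, 0 < α → α < 1 → ∀ γ : ℝ, 0 < γ → γ < 1 → ∃ c : ℝ, 0 < c ∧
      ∀ ν : ℝ, 0 < ν → ∀ (u₀ : UnitAddTorus (Fin 3) → EuclideanSpace ℝ (Fin 3)),
        IsSmooth u₀ → IsDivFree u₀ → ∀ K : ℝ, 0 ≤ K →
          Torus.eContDiffHolderNorm 1 (Real.toNNReal α) u₀ ≤ ENNReal.ofReal K →
          ∀ T' : ℝ, 0 < T' → T' * K ≤ c →
            ∃ (v : ℝ → UnitAddTorus (Fin 3) → EuclideanSpace ℝ (Fin 3)) (p : ℝ → UnitAddTorus (Fin 3) → ℝ),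
              Torus.IsFracNSReynoldsOn (Icc 0 T') γ ν v p (fun _ _ _ => 0) ∧ v 0 = u₀ := by
  intro α hα hα1 γ hγ hγ1
  have hα' : 0 < Real.toNNReal α := Real.toNNReal_pos.2 hα
  have hα'1 : Real.toNNReal α < 1 := Real.toNNReal_lt_one.2 hα1
  obtain ⟨c, hc, C, hC1, hapr⟩ := fracNSApriori hα' hα'1 4
  refine ⟨c, hc, fun ν hν u₀ hu₀ hdiv K hK hKu T' hT' hTK => ?_⟩
  -- the size `U = max K (c/T') > 0` of the datum, with `T' U ≤ c`
  set U : ℝ := max K (c / T') with hU_def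
  have hU : 0 < U := lt_max_of_lt_right (div_pos hc hT')
  have hKU : K ≤ U := le_max_left _ _
  have hTU : T' * U ≤ c := by
    rcases le_total K (c / T') with hle | hle
    · rw [hU_def, max_eq_right hle, mul_div_cancel₀ _ hT'.ne']
    · rw [hU_def, max_eq_left hle]; exact hTK
  -- the frequency `Λ ≥ 1` absorbing the higher norms of the datum
  have hfin : ∀ N, Torus.eContDiffHolderNorm N (Real.toNNReal α) u₀ ≠ ⊤ := fun N =>
    (hu₀.eContDiffHolderNorm_lt_top N hα'1.le).ne
  set X : ℝ := ∑ N ∈ Finset.range 5, (Torus.eContDiffHolderNorm N (Real.toNNReal α) u₀).toReal with hX_def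
  have hXN : ∀ N, N ≤ 4 → (Torus.eContDiffHolderNorm N (Real.toNNReal α) u₀).toReal ≤ X := by
    intro N hN
    rw [hX_def]
    exact Finset.single_le_sum (f := fun N => (Torus.eContDiffHolderNorm N (Real.toNNReal α) u₀).toReal)
      (fun _ _ => ENNReal.toReal_nonneg) (Finset.mem_range.2 (by omega))
  set Λ : ℝ := max 1 (X / U) with hΛ_def
  have hΛ : 1 ≤ Λ := le_max_left _ _
  have hXΛ : X ≤ U * Λ := by
    have h1 : X / U ≤ Λ := le_max_right _ _
    rwa [div_le_iff₀' hU] at h1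
  have hdat : ∀ N, 1 ≤ N → N ≤ 4 →
      Torus.eContDiffHolderNorm N (Real.toNNReal α) u₀ ≤ ENNReal.ofReal (U * Λ ^ (N - 1)) := by
    intro N h1 h4
    rcases Nat.eq_or_lt_of_le h1 with h | hlt
    · subst h
      rw [Nat.sub_self, pow_zero, mul_one]
      exact hKu.trans (ENNReal.ofReal_le_ofReal hKU)
    · rw [← ENNReal.ofReal_toReal (hfin N)]
      refine ENNReal.ofReal_le_ofReal (((hXN N h4).trans hXΛ).trans ?_)
      have hΛpow : Λ ≤ Λ ^ (N - 1) := by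
        calc Λ = Λ ^ 1 := (pow_one Λ).symm
          _ ≤ Λ ^ (N - 1) := pow_le_pow_right₀ hΛ (by omega)
      exact mul_le_mul_of_nonneg_left hΛpow hU.le
  -- the a priori bound `B = C U Λ³` of `‖v(t)‖_{4+α}` along solutions through `u₀` inside `[0, T']`
  set B : ℝ := C * U * Λ ^ 3 with hB_def
  have hB : 0 < B := by rw [hB_def]; positivity
  have hbound : ∀ (b : ℝ) (u : ℝ → UnitAddTorus (Fin 3) → EuclideanSpace ℝ (Fin 3))
      (p : ℝ → UnitAddTorus (Fin 3) → ℝ), 0 < b → b ≤ T' →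
      Torus.IsFracNSReynoldsOn (Icc 0 b) γ ν u p (fun _ _ _ => 0) → u 0 = u₀ →
        ∀ t ∈ Icc 0 b, Torus.eContDiffHolderNorm 4 (Real.toNNReal α) (u t) ≤ ENNReal.ofReal B := by
    intro b u p hb hbT hu hu0 t ht
    have hdat' : ∀ N, 1 ≤ N → N ≤ 4 →
        Torus.eContDiffHolderNorm N (Real.toNNReal α) (u 0) ≤ ENNReal.ofReal (U * Λ ^ (N - 1)) := by
      rw [hu0]; exact hdat
    have hbU : (b - 0) * U ≤ c := by
      rw [sub_zero]
      exact (mul_le_mul_of_nonneg_right hbT hU.le).trans hTU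
    have h4 := hapr hb hν.le hγ hγ1 hu hU hΛ hdat' hbU t ht 4 (by norm_num) le_rfl
    simpa [hB_def] using h4
  -- short-time existence for data with `‖·‖_{4+α} ≤ B`
  obtain ⟨h, hh, hloc⟩ := hshort α hα hα1 γ hγ hγ1 ν hν B hB
  -- the datum itself obeys the bound (`C ≥ 1`)
  have hP0 : Torus.eContDiffHolderNorm 4 (Real.toNNReal α) u₀ ≤ ENNReal.ofReal B := by
    refine (hdat 4 (by norm_num) le_rfl).trans (ENNReal.ofReal_le_ofReal ?_)
    rw [hB_def, show (4 - 1 : ℕ) = 3 from rfl]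
    have h0 : 0 ≤ U * Λ ^ 3 := by positivity
    nlinarith
  -- the base solution on `[0, b₀]`, `b₀ = min h T'`
  obtain ⟨v, q, hv, hv0, hq⟩ := hloc u₀ hu₀ hdiv hP0
  set b₀ : ℝ := min h T' with hb₀_def
  have hb₀ : 0 < b₀ := lt_min hh hT'
  have hb₀T : b₀ ≤ T' := min_le_right _ _
  have hb₀h : b₀ ≤ h := min_le_left _ _
  have hv' : Torus.IsFracNSReynoldsOn (Icc 0 b₀) γ ν v q (fun _ _ _ => 0) :=
    hv.mono (Icc_subset_Icc le_rfl hb₀h) (uniqueDiffOn_Icc hb₀)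
  have hq' : ∀ t ∈ Icc 0 b₀, HasZeroMean (q t) := fun t ht => hq t ⟨ht.1, ht.2.trans hb₀h⟩
  -- continuation to `[0, T']` in finitely many steps of length `h/2`
  obtain ⟨n, hn⟩ : ∃ n : ℕ, T' ≤ b₀ + n * (h / 2) := by
    obtain ⟨n, hn⟩ := exists_nat_ge (T' / (h / 2))
    refine ⟨n, ?_⟩
    have : T' ≤ n * (h / 2) := by rwa [div_le_iff₀ (half_pos hh)] at hn
    linarith [hb₀.le]
  obtain ⟨u, p, hu, hu0, -⟩ := Torus.IsFracNSReynoldsOn.extend_forward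
    (P := fun w => Torus.eContDiffHolderNorm 4 (Real.toNNReal α) w ≤ ENNReal.ofReal B)
    hloc hbound hγ.le hν.le hh hb₀ hb₀T hv' hv0 hq' n
  rw [min_eq_right hn] at hu
  exact ⟨u, p, hu, hu0⟩

/-- **De Rosa's gluing stage from short-time existence alone.** With the commutator estimate
`BDSV.commutatorCZBound` proved (`BDSV.commutatorCZBound_holds`) and the local existence theory
reduced to short-time existence by `DeRosa.localExistence₀_of_shortTime`, the named fact
`DeRosa.gluingStage` (De Rosa 2019, §5: Cor. 5.2, Props. 5.3–5.5) follows from the short-time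
existence statement for the fractional Navier–Stokes equations with smooth data.
[cite: Derosa2018, §3.2 Thm. 3.4, Prop. 3.5; §5.2] -/
theorem gluingStage_of_shortTime
    (hshort : ∀ α : ℝ, 0 < α → α < 1 → ∀ γ : ℝ, 0 < γ → γ < 1 → ∀ ν : ℝ, 0 < ν → ∀ M : ℝ, 0 < M →
      ∃ h : ℝ, 0 < h ∧ ∀ u₀ : UnitAddTorus (Fin 3) → EuclideanSpace ℝ (Fin 3),
        IsSmooth u₀ → IsDivFree u₀ →
          Torus.eContDiffHolderNorm 4 (Real.toNNReal α) u₀ ≤ ENNReal.ofReal M →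
            ∃ (v : ℝ → UnitAddTorus (Fin 3) → EuclideanSpace ℝ (Fin 3)) (p : ℝ → UnitAddTorus (Fin 3) → ℝ),
              Torus.IsFracNSReynoldsOn (Icc 0 h) γ ν v p (fun _ _ _ => 0) ∧ v 0 = u₀ ∧
                ∀ t ∈ Icc 0 h, HasZeroMean (p t)) :
    gluingStage :=
  gluingStage_of_localExistence₀_of_commutatorCZBound (localExistence₀_of_shortTime hshort)
    BDSV.commutatorCZBound_holds

end DeRosa

end Literature.Analysis.FluidPDE
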